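import Literature.InformationTheory.Coding.DecodingHardness
import HarnessLib

/-!
# Berlekamp–McEliece–van Tilborg 1978: COSET WEIGHTS is in `NP`, hence NP-complete

Companion of `DecodingHardness.lean` (the language `COSETWEIGHTS` and
`THREEDM ≤ₚ COSETWEIGHTS`). "It is easy to see that both COSET WEIGHTS and SUBSPACE WEIGHTS are in
NP" [BMvT1978, §III, p. 385]: a nondeterministic algorithm guesses the row selector `x ∈ 𝔽₂ᵐ` and
checks `|x| ≤ w` and `xA = y`. This file carries that out for the tree's language
`COSETWEIGHTS = (encodingCosetInstance ⊗ encodingNatBool).toLanguage cosetWeightsSet` (instances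
`(⟨m, n, A, y⟩, w)` coded as `⟨⟨bin m, ⟨bin n, ⟨⟨1ᵐ, framed rows⟩, y⟩⟩⟩, bin w⟩`):

* `CosetWeightsNP.V` — the verifier, assembled in the algebra of `FP` string functions (no machine is
  written): on `⟨x, c⟩` it checks `T` (`x` is the canonical code of an instance: `x` equals the
  re-encoding of its own fields, the rows being re-listed by a concatenation fold `Brick.foldCat` of
  `nthItemFn`, plus the row-length and `|y| = n` tests), `W1` (`|c| = m`), `W2` (the number of ones
  of `c` is `≤ w`: a sum fold `Brick.foldLoop addFn`, compared in binary by `ltFn`) and `W3` (for every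
  column `j < n`, the parity of `Σ_i c_i A_ij` (a sum fold, parity = first bit of the numeral) is
  `y_j`; an `allIdxFn`); `V ∈ FP`, one-bit, with the closed form `V_eq_true_iff`;
* `CosetWeightsNP.COSETWEIGHTS_mem_NP : COSETWEIGHTS ∈ NP` (witness = the bits of `x`, length
  `m ≤ |code|`);
* **`BerlekampMcElieceVanTilborg1978_cosetWeights_isNPComplete : IsNPComplete COSETWEIGHTS`** —
  "This proves that COSET WEIGHTS is NP-complete" [BMvT1978, §III, p. 385], with the hardness half
  `BerlekampMcElieceVanTilborg1978_cosetWeights_isNPHard` of `DecodingHardness.lean`.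

## References

* [BMvT1978] E. R. Berlekamp, R. J. McEliece, H. C. A. van Tilborg, *On the inherent
  intractability of certain coding problems*, IEEE Trans. Inform. Theory 24 (1978) 384–386, §III
  (p. 385). Bib key `BerlekampMcelieceVantilborg1978`.
* [AroraBarak2009] S. Arora, B. Barak, *Computational Complexity*, CUP 2009, Def. 2.1 (NP via
  certificates), §1.3 (closure of polynomial time), §0.1 (codes).
-/

noncomputable section

namespace Literature.InformationTheory.Coding

open _root_.Computability Literature.Computability.Complexity Literature.InformationTheory.QuantumCodes
open scoped Literature.Computability.Complexity.Notation

namespace CosetWeightsNP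

open Polynomial Brick HashBricks Plumb

/-! ### Small facts -/

/-- Parity is the first bit of a numeral. [folklore] -/
private theorem headD_encodeNat (s : ℕ) : (encodeNat s).headD false = decide (s % 2 = 1) := by
  have hv := bitsToNat_encodeNat s
  rcases h : encodeNat s with _ | ⟨b, l⟩
  · rw [h, bitsToNat_nil] at hv
    subst hv
    rfl
  · rw [h, bitsToNat_cons] at hv
    rw [List.headD_cons, ← hv]
    cases b <;> simp [Nat.add_mul_mod_self_left]

/-- A bit string is the table of its own bits. [folklore] -/
private theorem ofFn_getD {n : ℕ} {l : List Bool} (hl : l.length = n) :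
    (List.ofFn fun j : Fin n => l.getD j false) = l := by
  subst hl
  apply List.ext_getElem (by simp)
  intro i h1 h2
  rw [List.getElem_ofFn, List.getD_eq_getElem]

/-- The framed body of a list code is the concatenation of one-item frames (twin of
`Brick.frames_ofFn_eq_ccat_boolPair`, `SelectBricks.lean`, not in this import cone). [folklore] -/
private theorem frames_ofFn_eq_ccat (c : ℕ → List Bool) (n : ℕ) :
    frames (List.ofFn fun i : Fin n => c i) = ccat (fun i => boolPair (c i) []) n := by
  rw [frames_ofFn]
  exact ccat_congr fun i _ => by rw [boolPair_eq, List.append_nil]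

/-- First projections do not lengthen. [folklore] -/
private theorem length_fstF_le (z : List Bool) : (fstF z).length ≤ z.length := by
  have := length_fstF_sndF_le z; omega

/-- Second projections do not lengthen. [folklore] -/
private theorem length_sndF_le (z : List Bool) : (sndF z).length ≤ z.length := by
  have := length_fstF_sndF_le z; omega

/-! ### Fields of an instance string `x = ⟨⟨mn, ⟨nn, ⟨⟨um, R⟩, yv⟩⟩⟩, wn⟩` -/

/-- `m = ⟦fstF (fstF x)⟧`. [folklore] -/
def mOf (x : List Bool) : ℕ := bitsToNat (fstF (fstF x))
/-- `n = ⟦fstF (sndF (fstF x))⟧`. [folklore] -/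
def nOf (x : List Bool) : ℕ := bitsToNat (fstF (sndF (fstF x)))
/-- `w = ⟦sndF x⟧`. [folklore] -/
def wOf (x : List Bool) : ℕ := bitsToNat (sndF x)
/-- The framed rows `R`. [folklore] -/
def ROf (x : List Bool) : List Bool := sndF (fstF (sndF (sndF (fstF x))))
/-- The target vector bits `yv`. [folklore] -/
def yvOf (x : List Bool) : List Bool := sndF (sndF (sndF (fstF x)))
/-- Row `t` of `R` (junk past the end). [folklore] -/
def item (x : List Bool) (t : ℕ) : List Bool := fstF (sndF^[t] (ROf x))
/-- `m` clamped by `|x|` (the loop bound; `= m` on codes). [folklore] -/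
def mhat (x : List Bool) : ℕ := min (mOf x) x.length
/-- `n` clamped by `|x|`. [folklore] -/
def nhat (x : List Bool) : ℕ := min (nOf x) x.length

/-- The matrix read off `x`: `A t j = [row t has bit j set]`. [cite: BerlekampMcelieceVantilborg1978, §III.A (p. 385)] -/
def AOf (x : List Bool) : Fin (mOf x) → Fin (nOf x) → ZMod 2 := fun t j => if (item x t).getD j false then 1 else 0
/-- The target vector read off `x`. [cite: BerlekampMcelieceVantilborg1978, §III.A (p. 385)] -/
def yvecOf (x : List Bool) : Fin (nOf x) → ZMod 2 := fun j => if (yvOf x).getD j false then 1 else 0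
/-- The instance read off `x`. [cite: BerlekampMcelieceVantilborg1978, §III.A (p. 385)] -/
def instOf (x : List Bool) : (Σ m : ℕ, Σ n : ℕ, (Fin m → Fin n → ZMod 2) × (Fin n → ZMod 2)) × ℕ :=
  (⟨mOf x, nOf x, (AOf x, yvecOf x)⟩, wOf x)

/-- **The re-encoding of the fields of `x`** (with the clamped `m`). [cite: AroraBarak2009, §0.1] -/
def reb (x : List Bool) : List Bool :=
  boolPair (boolPair (encodeNat (mOf x)) (boolPair (encodeNat (nOf x))
    (boolPair (boolPair (ones (mhat x)) (ccat (fun t => boolPair (item x t) []) (mhat x))) (yvOf x))))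
    (encodeNat (wOf x))

/-- **`x` is the canonical code of an instance**: it equals its own re-encoding, `|yv| = n`, and
every row has length `n`. [cite: AroraBarak2009, §0.1] -/
def GoodShape (x : List Bool) : Prop :=
  x = reb x ∧ (yvOf x).length = nhat x ∧ ∀ t < mhat x, (item x t).length = nhat x

/-- Rows are parts of `x`. [folklore] -/
private theorem length_item_le (x : List Bool) (t : ℕ) : (item x t).length ≤ x.length := by
  unfold item ROf
  refine (length_fstF_le _).trans ((length_sndF_iterate_le t _).trans ?_)
  exact (length_sndF_le _).trans ((length_fstF_le _).trans ((length_sndF_le _).trans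
    ((length_sndF_le _).trans (length_fstF_le _))))

/-- On a good shape the clamps are off: `mhat = m`, `nhat = n`. [folklore] -/
private theorem clamps_of_goodShape {x : List Bool} (h : GoodShape x) : mhat x = mOf x ∧ nhat x = nOf x := by
  obtain ⟨hx, hy, -⟩ := h
  have hlen := congrArg List.length hx
  simp only [reb, length_boolPair, List.length_replicate] at hlen
  unfold mhat nhat at *
  omega

/-- **A good-shaped string is the code of the instance read off it.** [cite: AroraBarak2009, §0.1] -/
theorem encode_instOf {x : List Bool} (h : GoodShape x) :
    (encodingCosetInstance.pairBool encodingNatBool).encode (instOf x) = x := by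
  obtain ⟨hm, hn⟩ := clamps_of_goodShape h
  obtain ⟨hx, hy, hrows⟩ := h
  rw [hm] at hrows
  rw [hn] at hy hrows
  conv_rhs => rw [hx]
  show boolPair (boolPair (encodeNat (mOf x)) (boolPair (encodeNat (nOf x))
    (boolPair ((encodingFinVec (encodingF2Vec (nOf x)) (mOf x)).encode (AOf x))
      ((encodingF2Vec (nOf x)).encode (yvecOf x))))) (encodeNat (wOf x)) = _
  have hrow : ∀ t : Fin (mOf x), (encodingF2Vec (nOf x)).encode (AOf x t) = item x t := fun t => by
    show (List.ofFn fun j : Fin (nOf x) => decide ((if (item x t).getD j false then (1 : ZMod 2) else 0) = 1)) = _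
    conv_rhs => rw [← ofFn_getD (hrows t t.2)]
    congr 1; funext j
    cases (item x t).getD j false <;> decide
  have hyv : (encodingF2Vec (nOf x)).encode (yvecOf x) = yvOf x := by
    show (List.ofFn fun j : Fin (nOf x) => decide ((if (yvOf x).getD j false then (1 : ZMod 2) else 0) = 1)) = _
    conv_rhs => rw [← ofFn_getD hy]
    congr 1; funext j
    cases (yvOf x).getD j false <;> decide
  have hA : frames (List.ofFn fun i : Fin (mOf x) => (encodingF2Vec (nOf x)).encode (AOf x i)) =
      ccat (fun t => boolPair (item x t) []) (mOf x) := by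
    rw [← frames_ofFn_eq_ccat]
    exact congrArg frames (List.ofFn_inj.2 (funext hrow))
  rw [reb, hm, CosetWeights.encode_finVec_F2, hyv, hA]

/-! ### Codes of instances are good-shaped -/

section Code

variable (I : (Σ m : ℕ, Σ n : ℕ, (Fin m → Fin n → ZMod 2) × (Fin n → ZMod 2)) × ℕ)

/-- The code of an instance, spelled out. [cite: AroraBarak2009, §0.1] -/
theorem encode_eq :
    (encodingCosetInstance.pairBool encodingNatBool).encode I =
      boolPair (boolPair (encodeNat I.1.1) (boolPair (encodeNat I.1.2.1)
        (boolPair (boolPair (ones I.1.1) (ccat (fun t => boolPair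
          ((List.ofFn fun i : Fin I.1.1 => (encodingF2Vec I.1.2.1).encode (I.1.2.2.1 i)).getD t []) []) I.1.1))
          ((encodingF2Vec I.1.2.1).encode I.1.2.2.2)))) (encodeNat I.2) := by
  obtain ⟨⟨m, n, A, yvec⟩, w⟩ := I
  show boolPair (boolPair (encodeNat m) (boolPair (encodeNat n)
    (boolPair ((encodingFinVec (encodingF2Vec n) m).encode A) ((encodingF2Vec n).encode yvec)))) (encodeNat w) = _
  have hA : frames (List.ofFn fun i : Fin m => (encodingF2Vec n).encode (A i)) =
      ccat (fun t => boolPair ((List.ofFn fun i : Fin m => (encodingF2Vec n).encode (A i)).getD t []) []) m := by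
    rw [← frames_ofFn_eq_ccat]
    refine congrArg frames (List.ofFn_inj.2 (funext fun i => ?_))
    rw [List.getD_eq_getElem _ _ (by simp), List.getElem_ofFn]
  rw [CosetWeights.encode_finVec_F2, hA]

/-- The fields of a code. [cite: AroraBarak2009, §0.1] -/
theorem fields_encode :
    mOf ((encodingCosetInstance.pairBool encodingNatBool).encode I) = I.1.1 ∧
    nOf ((encodingCosetInstance.pairBool encodingNatBool).encode I) = I.1.2.1 ∧
    wOf ((encodingCosetInstance.pairBool encodingNatBool).encode I) = I.2 ∧
    yvOf ((encodingCosetInstance.pairBool encodingNatBool).encode I) = (encodingF2Vec I.1.2.1).encode I.1.2.2.2 ∧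
    ROf ((encodingCosetInstance.pairBool encodingNatBool).encode I) = ccat (fun t => boolPair
      ((List.ofFn fun i : Fin I.1.1 => (encodingF2Vec I.1.2.1).encode (I.1.2.2.1 i)).getD t []) []) I.1.1 := by
  simp only [mOf, nOf, wOf, yvOf, ROf, encode_eq, fstF_boolPair, sndF_boolPair, bitsToNat_encodeNat, and_self]

/-- The rows of a code. [cite: AroraBarak2009, §0.1] -/
theorem item_encode (t : ℕ) :
    item ((encodingCosetInstance.pairBool encodingNatBool).encode I) t =
      (List.ofFn fun i : Fin I.1.1 => (encodingF2Vec I.1.2.1).encode (I.1.2.2.1 i)).getD t [] := by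
  rw [item, (fields_encode I).2.2.2.2, ccat_frame_eq_encList, sndF_iterate_encList, fstF_encList]
  set L := (List.ofFn fun i : Fin I.1.1 => (encodingF2Vec I.1.2.1).encode (I.1.2.2.1 i)) with hL
  have hlen : L.length = I.1.1 := by rw [hL, List.length_ofFn]
  by_cases ht : t < I.1.1
  · have h1 : ((List.range I.1.1).map fun t => L.getD t []).drop t =
        L.getD t [] :: ((List.range I.1.1).map fun t => L.getD t []).drop (t + 1) := by
      rw [← List.getElem_cons_drop (by simpa using ht)]
      simp
    rw [h1, List.headD_cons]
  · rw [List.drop_eq_nil_of_le (by simpa using Nat.le_of_not_lt ht), List.headD_nil,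
      List.getD_eq_default _ _ (by rw [hlen]; exact Nat.le_of_not_lt ht)]

/-- `m ≤ |code|`. [folklore] -/
private theorem m_le_length_encode : I.1.1 ≤ ((encodingCosetInstance.pairBool encodingNatBool).encode I).length := by
  rw [encode_eq]; simp only [length_boolPair, List.length_replicate]; omega

/-- `n ≤ |code|`. [folklore] -/
private theorem n_le_length_encode : I.1.2.1 ≤ ((encodingCosetInstance.pairBool encodingNatBool).encode I).length := by
  have : ((encodingF2Vec I.1.2.1).encode I.1.2.2.2).length = I.1.2.1 := by
    show (List.ofFn _).length = _; rw [List.length_ofFn]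
  rw [encode_eq]; simp only [length_boolPair, List.length_replicate]; omega

/-- The clamps on a code. [folklore] -/
private theorem clamps_encode :
    mhat ((encodingCosetInstance.pairBool encodingNatBool).encode I) = I.1.1 ∧
    nhat ((encodingCosetInstance.pairBool encodingNatBool).encode I) = I.1.2.1 := by
  rw [mhat, nhat, (fields_encode I).1, (fields_encode I).2.1, Nat.min_eq_left (m_le_length_encode I),
    Nat.min_eq_left (n_le_length_encode I)]
  exact ⟨rfl, rfl⟩

/-- Row codes have length `n`. [folklore] -/
private theorem length_row (i : Fin I.1.1) : ((encodingF2Vec I.1.2.1).encode (I.1.2.2.1 i)).length = I.1.2.1 := by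
  show (List.ofFn _).length = _; rw [List.length_ofFn]

/-- **Codes are good-shaped.** [cite: AroraBarak2009, §0.1] -/
theorem goodShape_encode : GoodShape ((encodingCosetInstance.pairBool encodingNatBool).encode I) := by
  obtain ⟨hm, hn⟩ := clamps_encode I
  obtain ⟨h1, h2, h3, h4, h5⟩ := fields_encode I
  refine ⟨?_, ?_, fun t ht => ?_⟩
  · have hc : ccat (fun t => boolPair (item ((encodingCosetInstance.pairBool encodingNatBool).encode I) t) []) I.1.1 =
        ccat (fun t => boolPair ((List.ofFn fun i : Fin I.1.1 => (encodingF2Vec I.1.2.1).encode (I.1.2.2.1 i)).getD t []) [])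
          I.1.1 := ccat_congr fun t _ => by rw [item_encode]
    rw [reb, h1, h2, h3, h4, hm, hc, ← encode_eq]
  · rw [h4, hn]; show (List.ofFn _).length = _; rw [List.length_ofFn]
  · rw [hm] at ht
    rw [item_encode, hn, List.getD_eq_getElem _ _ (by simpa using ht), List.getElem_ofFn, length_row]

end Code

/-! ### The instance test `T` (bricks) -/

/-- On `x`: the numeral `mn`. [folklore] -/
def mnF : List Bool → List Bool := fstF ∘ fstF
/-- On `x`: the numeral `nn`. [folklore] -/
def nnF : List Bool → List Bool := fstF ∘ sndF ∘ fstF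
/-- On `x`: the target bits `yv`. [folklore] -/
def yvF : List Bool → List Bool := sndF ∘ sndF ∘ sndF ∘ fstF
/-- On `x`: the framed rows `R`. [folklore] -/
def RF : List Bool → List Bool := sndF ∘ fstF ∘ sndF ∘ sndF ∘ fstF
/-- On `x`: `1^{mhat}`. [folklore] -/
def mhatF : List Bool → List Bool := binToUnaryFn ∘ fanoutFn id mnF
/-- On `x`: `1^{nhat}`. [folklore] -/
def nhatF : List Bool → List Bool := binToUnaryFn ∘ fanoutFn id nnF
/-- On `⟨x, 1ᵗ⟩`: row `t`. [folklore] -/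
def itemF : List Bool → List Bool := nthItemFn ∘ fanoutFn sndF (RF ∘ fstF)
/-- On `⟨x, 1ᵗ⟩`: the framed row `⟨row t, ε⟩`. [folklore] -/
def rowPieceF : List Bool → List Bool := fanoutFn itemF (fun _ => [])
/-- On `x`: the re-listed rows (concatenation fold over `t < mhat`). [cite: AroraBarak2009, §1.3 (bounded loops)] -/
def rrebF : List Bool → List Bool := foldCat (2 * X + 2) X rowPieceF ∘ fanoutFn id mhatF
/-- On `x`: **the re-encoding** `reb x`. [cite: AroraBarak2009, §0.1] -/
def rebF : List Bool → List Bool :=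
  fanoutFn (fanoutFn (norm ∘ mnF) (fanoutFn (norm ∘ nnF) (fanoutFn (fanoutFn mhatF rrebF) yvF))) (norm ∘ sndF)
/-- On `x`: `[x = reb x]`. [folklore] -/
def t0 : List Bool → List Bool := eqPairFn ∘ fanoutFn id rebF
/-- On `x`: `[|yv| = nhat]`. [folklore] -/
def t1 : List Bool → List Bool := eqPairFn ∘ fanoutFn (onesFn ∘ yvF) nhatF
/-- On `⟨x, 1ᵗ⟩`: `[|row t| = nhat]`. [folklore] -/
def cLen : List Bool → List Bool := eqPairFn ∘ fanoutFn (onesFn ∘ itemF) (nhatF ∘ fstF)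
/-- On `x`: all rows have length `nhat`. [folklore] -/
def t2 : List Bool → List Bool := allIdxFn mhatF cLen
/-- **The instance test** on `x`. [cite: AroraBarak2009, §0.1] -/
def T : List Bool → List Bool := andFn t0 (andFn t1 t2)

/-- `mhatF ∈ FP`. [cite: AroraBarak2009, §1.3 (polynomial time is closed under composition)] -/
theorem mhatF_mem_FP : mhatF ∈ FP :=
  comp_mem_FP binToUnaryFn_mem_FP (fanoutFn_mem_FP OracleCompose.id_mem_FP (comp_mem_FP fstF_mem_FP fstF_mem_FP))

/-- `nhatF ∈ FP`. [cite: AroraBarak2009, §1.3 (polynomial time is closed under composition)] -/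
theorem nhatF_mem_FP : nhatF ∈ FP :=
  comp_mem_FP binToUnaryFn_mem_FP (fanoutFn_mem_FP OracleCompose.id_mem_FP
    (comp_mem_FP fstF_mem_FP (comp_mem_FP sndF_mem_FP fstF_mem_FP)))

/-- `yvF ∈ FP`. [cite: AroraBarak2009, §1.3 (polynomial time is closed under composition)] -/
theorem yvF_mem_FP : yvF ∈ FP :=
  comp_mem_FP sndF_mem_FP (comp_mem_FP sndF_mem_FP (comp_mem_FP sndF_mem_FP fstF_mem_FP))

/-- `RF ∈ FP`. [cite: AroraBarak2009, §1.3 (polynomial time is closed under composition)] -/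
theorem RF_mem_FP : RF ∈ FP :=
  comp_mem_FP sndF_mem_FP (comp_mem_FP fstF_mem_FP (comp_mem_FP sndF_mem_FP (comp_mem_FP sndF_mem_FP fstF_mem_FP)))

/-- `itemF ∈ FP`. [cite: AroraBarak2009, §1.3 (polynomial time is closed under composition)] -/
theorem itemF_mem_FP : itemF ∈ FP :=
  comp_mem_FP nthItemFn_mem_FP (fanoutFn_mem_FP sndF_mem_FP (comp_mem_FP RF_mem_FP fstF_mem_FP))

/-- `rebF ∈ FP`. [cite: AroraBarak2009, §1.3 (polynomial time is closed under composition and bounded loops)] -/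
theorem rebF_mem_FP : rebF ∈ FP := by
  have hr : rrebF ∈ FP := comp_mem_FP (foldCat_mem_FP _ _ (fanoutFn_mem_FP itemF_mem_FP (const_mem_FP _)))
    (fanoutFn_mem_FP OracleCompose.id_mem_FP mhatF_mem_FP)
  exact fanoutFn_mem_FP (fanoutFn_mem_FP (comp_mem_FP norm_mem_FP (comp_mem_FP fstF_mem_FP fstF_mem_FP))
    (fanoutFn_mem_FP (comp_mem_FP norm_mem_FP (comp_mem_FP fstF_mem_FP (comp_mem_FP sndF_mem_FP fstF_mem_FP)))
      (fanoutFn_mem_FP (fanoutFn_mem_FP mhatF_mem_FP hr) yvF_mem_FP))) (comp_mem_FP norm_mem_FP sndF_mem_FP)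

/-- `cLen ∈ FP`. [cite: AroraBarak2009, §1.3 (polynomial time is closed under composition)] -/
theorem cLen_mem_FP : cLen ∈ FP :=
  comp_mem_FP eqPairFn_mem_FP (fanoutFn_mem_FP (comp_mem_FP onesFn_mem_FP itemF_mem_FP) (comp_mem_FP nhatF_mem_FP fstF_mem_FP))

/-- **`T ∈ FP`.** [cite: AroraBarak2009, §1.3 (polynomial time is closed under composition and bounded loops)] -/
theorem T_mem_FP : T ∈ FP :=
  andFn_mem_FP (comp_mem_FP eqPairFn_mem_FP (fanoutFn_mem_FP OracleCompose.id_mem_FP rebF_mem_FP))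
    (andFn_mem_FP (comp_mem_FP eqPairFn_mem_FP (fanoutFn_mem_FP (comp_mem_FP onesFn_mem_FP yvF_mem_FP) nhatF_mem_FP))
      (allIdxFn_mem_FP mhatF_mem_FP cLen_mem_FP (oneBit_eqPairFn.comp _)))

/-- `T` is one-bit. [cite: AroraBarak2009, §1.3 (polynomial time is closed under composition)] -/
theorem oneBit_T : OneBit T := by
  refine oneBit_andFn (oneBit_eqPairFn.comp _) (oneBit_andFn (oneBit_eqPairFn.comp _)
    (oneBit_allIdxFn (oneBit_eqPairFn.comp _) fun u => ?_))
  rw [mhatF, Function.comp_apply, fanoutFn_apply, binToUnaryFn_boolPair, List.length_replicate]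
  exact Nat.min_le_right _ _

/-- Value of `mhatF`. [folklore] -/
private theorem mhatF_apply (x : List Bool) : mhatF x = ones (mhat x) := by
  rw [mhatF, Function.comp_apply, fanoutFn_apply, binToUnaryFn_boolPair]; rfl

/-- Value of `nhatF`. [folklore] -/
private theorem nhatF_apply (x : List Bool) : nhatF x = ones (nhat x) := by
  rw [nhatF, Function.comp_apply, fanoutFn_apply, binToUnaryFn_boolPair]; rfl

/-- Value of `itemF`. [folklore] -/
private theorem itemF_apply (x : List Bool) (t : ℕ) : itemF (boolPair x (ones t)) = item x t := by
  rw [itemF, Function.comp_apply, fanoutFn_apply, sndF_boolPair, Function.comp_apply, fstF_boolPair, nthItemFn_boolPair,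
    List.length_replicate]; rfl

/-- The clamp is within the input length. [folklore] -/
private theorem mhat_le (x : List Bool) : mhat x ≤ x.length := Nat.min_le_right _ _

/-- The clamp is within the input length. [folklore] -/
private theorem nhat_le (x : List Bool) : nhat x ≤ x.length := Nat.min_le_right _ _

/-- Value of `rebF`. [folklore] -/
private theorem rebF_apply (x : List Bool) : rebF x = reb x := by
  have hr : rrebF x = ccat (fun t => boolPair (item x t) []) (mhat x) := by
    rw [rrebF, Function.comp_apply, fanoutFn_apply, mhatF_apply, id,
      foldCat_apply (by rw [List.length_replicate, eval_X]; exact mhat_le x)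
        (fun t _ => by
          rw [rowPieceF, fanoutFn_apply, itemF_apply, length_boolPair, List.length_nil]
          simp only [eval_add, eval_mul, eval_ofNat, eval_X]
          have := length_item_le x t; omega), List.length_replicate]
    exact ccat_congr fun t _ => by rw [rowPieceF, fanoutFn_apply, itemF_apply]
  simp only [rebF, fanoutFn_apply, Function.comp_apply, norm_eq_encodeNat, mhatF_apply, hr, reb, mnF, nnF, yvF, mOf, nOf,
    wOf, yvOf]

/-- **Truth of the instance test.** [cite: AroraBarak2009, §0.1] -/
theorem T_eq_true_iff (x : List Bool) : T x = [true] ↔ GoodShape x := by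
  have h0 : t0 x = [decide (x = reb x)] := by
    rw [t0, Function.comp_apply, fanoutFn_apply, rebF_apply, eqPairFn_boolPair]; rfl
  have h1 : t1 x = [decide ((yvOf x).length = nhat x)] := by
    rw [t1, Function.comp_apply, fanoutFn_apply, nhatF_apply, Function.comp_apply, ThreeDMNP.onesFn_eq_ones, eqPairFn_boolPair]
    simp [yvF, yvOf]
  have h2 : t2 x = [decide (∀ t < mhat x, (item x t).length = nhat x)] := by
    have hcl : OneBit cLen := oneBit_eqPairFn.comp _
    rw [t2, allIdxFn_apply hcl (h := mhatF) (by rw [mhatF_apply, List.length_replicate]; exact mhat_le x),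
      mhatF_apply, List.length_replicate]
    have hc : ∀ t, cLen (boolPair x (ones t)) = [decide ((item x t).length = nhat x)] := fun t => by
      rw [cLen, Function.comp_apply, fanoutFn_apply, Function.comp_apply, itemF_apply, ThreeDMNP.onesFn_eq_ones,
        Function.comp_apply, fstF_boolPair, nhatF_apply, eqPairFn_boolPair]
      simp
    simp [hc]
  rw [T, andFn_apply h0 (andFn_apply h1 h2), GoodShape]
  simp [Bool.and_eq_true, decide_eq_true_eq]

/-! ### The witness checks (bricks) -/

/-- Number of ones among the first `k` bits of `c`. [cite: BerlekampMcelieceVantilborg1978, §III.A (p. 385: "Hamming weight ≤ w")] -/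
def wt (c : List Bool) (k : ℕ) : ℕ := ∑ i ∈ Finset.range k, (c.getD i false).toNat

/-- The column sum `Σ_{i<k} c_i A_ij` over `ℕ`. [cite: BerlekampMcelieceVantilborg1978, §III.A (p. 385: "xA = y")] -/
def colSum (x c : List Bool) (j k : ℕ) : ℕ := ∑ i ∈ Finset.range k, (c.getD i false && (item x i).getD j false).toNat

/-- On `⟨u, 1ⁱ⟩`, `u = ⟨x, c⟩`: the witness bit `[cᵢ]`. [folklore] -/
def cbitF : List Bool → List Bool := headBitFn ∘ bitAtFn ∘ fanoutFn sndF (sndF ∘ fstF)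
/-- On `u`: the fold record `⟨u, ⟨bin mhat, ⟨1⁰, bin 0⟩⟩⟩`. [folklore] -/
def initW : List Bool → List Bool := fanoutFn id (fanoutFn (lenBinF ∘ mhatF ∘ fstF) (fun _ => boolPair [] []))
/-- On `u`: the numeral of the weight of `c` (sum fold). [cite: AroraBarak2009, §1.3 (bounded loops)] -/
def sumW : List Bool → List Bool := sndPow 2 ∘ foldLoop addFn cbitF X ∘ initW
/-- On `u`: `[weight ≤ w]`. [cite: BerlekampMcelieceVantilborg1978, §III.A (p. 385)] -/
def W2 : List Bool → List Bool := notFn (ltFn ∘ fanoutFn (sndF ∘ fstF) sumW)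
/-- On `u`: `[|c| = mhat]`. [folklore] -/
def W1 : List Bool → List Bool := eqPairFn ∘ fanoutFn (onesFn ∘ sndF) (mhatF ∘ fstF)
/-- On `⟨⟨u, 1ʲ⟩, 1ⁱ⟩`: `[cᵢ ∧ A_ij]`. [folklore] -/
def pbitF : List Bool → List Bool :=
  andFn (headBitFn ∘ bitAtFn ∘ fanoutFn sndF (sndF ∘ fstF ∘ fstF))
    (headBitFn ∘ bitAtFn ∘ fanoutFn (sndF ∘ fstF) (itemF ∘ fanoutFn (fstF ∘ fstF ∘ fstF) sndF))
/-- On `r = ⟨u, 1ʲ⟩`: the fold record `⟨r, ⟨bin mhat, ⟨1⁰, bin 0⟩⟩⟩`. [folklore] -/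
def initC : List Bool → List Bool := fanoutFn id (fanoutFn (lenBinF ∘ mhatF ∘ fstF ∘ fstF) (fun _ => boolPair [] []))
/-- On `r`: the numeral of the column sum (sum fold). [cite: AroraBarak2009, §1.3 (bounded loops)] -/
def sumC : List Bool → List Bool := sndPow 2 ∘ foldLoop addFn pbitF X ∘ initC
/-- On `r`: `[parity of the column sum = y_j]`. [cite: BerlekampMcelieceVantilborg1978, §III.A (p. 385)] -/
def colC : List Bool → List Bool :=
  eqPairFn ∘ fanoutFn (headBitFn ∘ sumC) (headBitFn ∘ bitAtFn ∘ fanoutFn sndF (yvF ∘ fstF ∘ fstF))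
/-- On `u`: all columns check. [cite: BerlekampMcelieceVantilborg1978, §III.A (p. 385)] -/
def W3 : List Bool → List Bool := allIdxFn (nhatF ∘ fstF) colC
/-- **The verifier** `V = T ∧ W1 ∧ W2 ∧ W3` on `u = ⟨x, c⟩`. [cite: BerlekampMcelieceVantilborg1978, §III (p. 385: "It is easy to see that both COSET WEIGHTS and SUBSPACE WEIGHTS are in NP")] -/
def V : List Bool → List Bool := andFn (T ∘ fstF) (andFn W1 (andFn W2 W3))

/-- One-bit functions have linear growth. [folklore] -/
private theorem length_le_of_oneBit {f : List Bool → List Bool} (hf : OneBit f) (z : List Bool) :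
    (f z).length ≤ 1 * ((fstF z).length + 1) := by
  rw [hf.length_eq]; omega

/-- `cbitF ∈ FP`. [cite: AroraBarak2009, §1.3 (polynomial time is closed under composition)] -/
theorem cbitF_mem_FP : cbitF ∈ FP :=
  comp_mem_FP headBitFn_mem_FP (comp_mem_FP bitAtFn_mem_FP (fanoutFn_mem_FP sndF_mem_FP (comp_mem_FP sndF_mem_FP fstF_mem_FP)))

/-- `pbitF ∈ FP`. [cite: AroraBarak2009, §1.3 (polynomial time is closed under composition)] -/
theorem pbitF_mem_FP : pbitF ∈ FP :=
  andFn_mem_FP (comp_mem_FP headBitFn_mem_FP (comp_mem_FP bitAtFn_mem_FP (fanoutFn_mem_FP sndF_mem_FP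
    (comp_mem_FP sndF_mem_FP (comp_mem_FP fstF_mem_FP fstF_mem_FP)))))
    (comp_mem_FP headBitFn_mem_FP (comp_mem_FP bitAtFn_mem_FP (fanoutFn_mem_FP (comp_mem_FP sndF_mem_FP fstF_mem_FP)
      (comp_mem_FP itemF_mem_FP (fanoutFn_mem_FP (comp_mem_FP fstF_mem_FP (comp_mem_FP fstF_mem_FP fstF_mem_FP)) sndF_mem_FP)))))

/-- `sumW ∈ FP`. [cite: AroraBarak2009, §1.3 (polynomial time is closed under composition and bounded loops)] -/
theorem sumW_mem_FP : sumW ∈ FP :=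
  comp_mem_FP (sndPow_mem_FP 2) (comp_mem_FP
    (foldLoop_mem_FP addFn_mem_FP length_addFn_le cbitF_mem_FP (length_le_of_oneBit (oneBit_headBitFn.comp _)) X)
    (fanoutFn_mem_FP OracleCompose.id_mem_FP (fanoutFn_mem_FP
      (comp_mem_FP lenBinF_mem_FP (comp_mem_FP mhatF_mem_FP fstF_mem_FP)) (const_mem_FP _))))

/-- `sumC ∈ FP`. [cite: AroraBarak2009, §1.3 (polynomial time is closed under composition and bounded loops)] -/
theorem sumC_mem_FP : sumC ∈ FP :=
  comp_mem_FP (sndPow_mem_FP 2) (comp_mem_FP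
    (foldLoop_mem_FP addFn_mem_FP length_addFn_le pbitF_mem_FP
      (length_le_of_oneBit (oneBit_andFn (oneBit_headBitFn.comp _) (oneBit_headBitFn.comp _))) X)
    (fanoutFn_mem_FP OracleCompose.id_mem_FP (fanoutFn_mem_FP
      (comp_mem_FP lenBinF_mem_FP (comp_mem_FP mhatF_mem_FP (comp_mem_FP fstF_mem_FP fstF_mem_FP))) (const_mem_FP _))))

/-- `colC ∈ FP`. [cite: AroraBarak2009, §1.3 (polynomial time is closed under composition)] -/
theorem colC_mem_FP : colC ∈ FP :=
  comp_mem_FP eqPairFn_mem_FP (fanoutFn_mem_FP (comp_mem_FP headBitFn_mem_FP sumC_mem_FP)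
    (comp_mem_FP headBitFn_mem_FP (comp_mem_FP bitAtFn_mem_FP (fanoutFn_mem_FP sndF_mem_FP
      (comp_mem_FP yvF_mem_FP (comp_mem_FP fstF_mem_FP fstF_mem_FP))))))

/-- **`V ∈ FP`.** [cite: AroraBarak2009, §1.3 (polynomial time is closed under composition and bounded loops)] -/
theorem V_mem_FP : V ∈ FP :=
  andFn_mem_FP (comp_mem_FP T_mem_FP fstF_mem_FP) (andFn_mem_FP
    (comp_mem_FP eqPairFn_mem_FP (fanoutFn_mem_FP (comp_mem_FP onesFn_mem_FP sndF_mem_FP) (comp_mem_FP mhatF_mem_FP fstF_mem_FP)))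
    (andFn_mem_FP (notFn_mem_FP (comp_mem_FP ltFn_mem_FP (fanoutFn_mem_FP (comp_mem_FP sndF_mem_FP fstF_mem_FP) sumW_mem_FP)))
      (allIdxFn_mem_FP (comp_mem_FP nhatF_mem_FP fstF_mem_FP) colC_mem_FP (oneBit_eqPairFn.comp _))))

/-- `W3` is one-bit. [cite: AroraBarak2009, §1.3 (polynomial time is closed under composition)] -/
theorem oneBit_W3 : OneBit W3 :=
  oneBit_allIdxFn (oneBit_eqPairFn.comp _) fun u => by
    rw [Function.comp_apply, nhatF_apply, List.length_replicate]
    exact (nhat_le _).trans (length_fstF_le u)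

/-- `W1` is one-bit. [cite: AroraBarak2009, §1.3 (polynomial time is closed under composition)] -/
theorem oneBit_W1 : OneBit W1 := oneBit_eqPairFn.comp _

/-- `W2` is one-bit. [cite: AroraBarak2009, §1.3 (polynomial time is closed under composition)] -/
theorem oneBit_W2 : OneBit W2 := oneBit_notFn (oneBit_ltFn.comp _)

/-- **`V` is one-bit.** [cite: AroraBarak2009, §1.3 (polynomial time is closed under composition)] -/
theorem oneBit_V : OneBit V :=
  oneBit_andFn (oneBit_T.comp _) (oneBit_andFn oneBit_W1 (oneBit_andFn oneBit_W2 oneBit_W3))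

/-! ### Values of the witness checks -/

/-- A single bit as a numeral. [folklore] -/
private theorem bitsToNat_single (b : Bool) : bitsToNat [b] = b.toNat := by
  rw [bitsToNat_cons, bitsToNat_nil]; omega

/-- Value of `cbitF`. [folklore] -/
private theorem cbitF_apply (x c : List Bool) (i : ℕ) : cbitF (boolPair (boolPair x c) (ones i)) = [c.getD i false] := by
  simp only [cbitF, Function.comp_apply, fanoutFn_apply, sndF_boolPair, fstF_boolPair, bitAtFn_boolPair,
    List.length_replicate, headBitFn_apply, ThreeDMNP.headD_take_drop]

/-- Value of `sumW`. [folklore] -/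
private theorem sumW_apply (x c : List Bool) : sumW (boolPair x c) = encodeNat (wt c (mhat x)) := by
  have hinit : initW (boolPair x c) =
      boolPair (boolPair x c) (boolPair (encodeNat (mhat x)) (boolPair (ones 0) (encodeNat 0))) := by
    simp only [initW, fanoutFn_apply, id, Function.comp_apply, fstF_boolPair, mhatF_apply, lenBinF_apply,
      List.length_replicate]; rfl
  have hk : mhat x ≤ (X : Polynomial ℕ).eval (boolPair x c).length := by
    rw [eval_X, length_boolPair]; have := mhat_le x; omega
  rw [sumW, Function.comp_apply, Function.comp_apply, hinit, foldLoop_apply addFn cbitF hk 0 (encodeNat 0), foldAcc_addFn]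
  simp only [sndPow, Function.comp_apply, sndF_boolPair, Nat.zero_add, cbitF_apply, bitsToNat_single, wt]

/-- Value of `W2`. [folklore] -/
private theorem W2_apply (x c : List Bool) : W2 (boolPair x c) = [!decide (wOf x < wt c (mhat x))] := by
  rw [W2, notFn_apply]
  rw [Function.comp_apply, fanoutFn_apply, Function.comp_apply, fstF_boolPair, sumW_apply, ltFn_boolPair,
    bitsToNat_encodeNat]; rfl

/-- Value of `W1`. [folklore] -/
private theorem W1_apply (x c : List Bool) : W1 (boolPair x c) = [decide (c.length = mhat x)] := by
  rw [W1, Function.comp_apply, fanoutFn_apply, Function.comp_apply, sndF_boolPair, ThreeDMNP.onesFn_eq_ones,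
    Function.comp_apply, fstF_boolPair, mhatF_apply, eqPairFn_boolPair]
  simp

/-- Value of `pbitF`. [folklore] -/
private theorem pbitF_apply (x c : List Bool) (j i : ℕ) :
    pbitF (boolPair (boolPair (boolPair x c) (ones j)) (ones i)) = [c.getD i false && (item x i).getD j false] := by
  have h1 : (headBitFn ∘ bitAtFn ∘ fanoutFn sndF (sndF ∘ fstF ∘ fstF)) (boolPair (boolPair (boolPair x c) (ones j)) (ones i)) =
      [c.getD i false] := by
    simp only [Function.comp_apply, fanoutFn_apply, sndF_boolPair, fstF_boolPair, bitAtFn_boolPair, List.length_replicate,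
      headBitFn_apply, ThreeDMNP.headD_take_drop]
  have h2 : (headBitFn ∘ bitAtFn ∘ fanoutFn (sndF ∘ fstF) (itemF ∘ fanoutFn (fstF ∘ fstF ∘ fstF) sndF))
      (boolPair (boolPair (boolPair x c) (ones j)) (ones i)) = [(item x i).getD j false] := by
    simp only [Function.comp_apply, fanoutFn_apply, sndF_boolPair, fstF_boolPair, itemF_apply, bitAtFn_boolPair,
      List.length_replicate, headBitFn_apply, ThreeDMNP.headD_take_drop]
  rw [pbitF, andFn_apply h1 h2]

/-- Value of `sumC`. [folklore] -/
private theorem sumC_apply (x c : List Bool) (j : ℕ) :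
    sumC (boolPair (boolPair x c) (ones j)) = encodeNat (colSum x c j (mhat x)) := by
  have hinit : initC (boolPair (boolPair x c) (ones j)) =
      boolPair (boolPair (boolPair x c) (ones j)) (boolPair (encodeNat (mhat x)) (boolPair (ones 0) (encodeNat 0))) := by
    simp only [initC, fanoutFn_apply, id, Function.comp_apply, fstF_boolPair, mhatF_apply, lenBinF_apply,
      List.length_replicate]; rfl
  have hk : mhat x ≤ (X : Polynomial ℕ).eval (boolPair (boolPair x c) (ones j)).length := by
    rw [eval_X, length_boolPair, length_boolPair]; have := mhat_le x; omega
  rw [sumC, Function.comp_apply, Function.comp_apply, hinit, foldLoop_apply addFn pbitF hk 0 (encodeNat 0), foldAcc_addFn]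
  simp only [sndPow, Function.comp_apply, sndF_boolPair, Nat.zero_add, pbitF_apply, bitsToNat_single, colSum]

/-- Value of `colC`. [folklore] -/
private theorem colC_apply (x c : List Bool) (j : ℕ) :
    colC (boolPair (boolPair x c) (ones j)) = [decide (decide (colSum x c j (mhat x) % 2 = 1) = (yvOf x).getD j false)] := by
  have h2 : (headBitFn ∘ bitAtFn ∘ fanoutFn sndF (yvF ∘ fstF ∘ fstF)) (boolPair (boolPair x c) (ones j)) =
      [(yvOf x).getD j false] := by
    simp only [Function.comp_apply, fanoutFn_apply, sndF_boolPair, fstF_boolPair, bitAtFn_boolPair, List.length_replicate,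
      headBitFn_apply, ThreeDMNP.headD_take_drop, yvF, yvOf]
  rw [colC, Function.comp_apply, fanoutFn_apply, h2, Function.comp_apply, sumC_apply, headBitFn_apply, headD_encodeNat,
    eqPairFn_boolPair]
  simp

/-- Value of `W3`. [folklore] -/
private theorem W3_apply (x c : List Bool) :
    W3 (boolPair x c) = [decide (∀ j < nhat x, decide (colSum x c j (mhat x) % 2 = 1) = (yvOf x).getD j false)] := by
  have hco : OneBit colC := oneBit_eqPairFn.comp _
  rw [W3, allIdxFn_apply hco (h := nhatF ∘ fstF)
    (by rw [Function.comp_apply, fstF_boolPair, nhatF_apply, List.length_replicate, length_boolPair]; have := nhat_le x; omega),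
    Function.comp_apply, fstF_boolPair, nhatF_apply, List.length_replicate]
  simp [colC_apply]

/-- **Value of the verifier.** [cite: BerlekampMcelieceVantilborg1978, §III (p. 385)] -/
theorem V_eq_true_iff (x c : List Bool) :
    V (boolPair x c) = [true] ↔ GoodShape x ∧ c.length = mhat x ∧ wt c (mhat x) ≤ wOf x ∧
      ∀ j < nhat x, decide (colSum x c j (mhat x) % 2 = 1) = (yvOf x).getD j false := by
  rw [V, andFn_eq_true_iff (oneBit_T.comp fstF) (oneBit_andFn oneBit_W1 (oneBit_andFn oneBit_W2 oneBit_W3)),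
    Function.comp_apply, fstF_boolPair, T_eq_true_iff, andFn_apply (W1_apply x c) (andFn_apply (W2_apply x c) (W3_apply x c))]
  simp only [List.cons.injEq, and_true, Bool.and_eq_true, Bool.not_eq_true', decide_eq_false_iff_not, not_lt,
    decide_eq_true_eq]

/-! ### The verifier's language -/

/-- The verifier's language. [cite: BerlekampMcelieceVantilborg1978, §III (p. 385)] -/
def Rlang : Language Bool := {u | V u = [true]}

/-- **`Rlang ∈ P`.** [cite: AroraBarak2009, Def. 1.13] -/
theorem Rlang_mem_P : Rlang ∈ Classes.P :=
  mem_P_of_mem_FP V_mem_FP _ fun u =>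
    ⟨fun h => h, fun h => by
      obtain ⟨b, hb⟩ := oneBit_V u
      cases b
      · exact hb
      · exact absurd hb h⟩

/-! ### Soundness and completeness -/

/-- `Bool.toNat` as an indicator. [folklore] -/
private theorem toNat_eq_ite (b : Bool) : b.toNat = if b = true then 1 else 0 := by cases b <;> rfl

/-- Residues mod `2` as elements of `𝔽₂`. [folklore] -/
private theorem natCast_eq_ite_iff (S : ℕ) (b : Bool) :
    ((S : ZMod 2) = if b = true then 1 else 0) ↔ decide (S % 2 = 1) = b := by
  rw [← ZMod.natCast_mod S 2]
  have h := Nat.mod_lt S two_pos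
  interval_cases hS : S % 2 <;> cases b <;> simp

/-- A range sum of bit indicators is the number of set positions. [folklore] -/
private theorem sum_range_toNat_eq_card (k : ℕ) (P : ℕ → Bool) :
    ∑ i ∈ Finset.range k, (P i).toNat = ((Finset.univ : Finset (Fin k)).filter fun i : Fin k => P (i : ℕ) = true).card := by
  rw [← Fin.sum_univ_eq_sum_range (fun i => (P i).toNat) k, Finset.card_filter]
  exact Finset.sum_congr rfl fun i _ => toNat_eq_ite _

/-- **The semantic content of the witness checks**: for `c` of length `m`, the row selector
`x_i = [c_i]` has weight `wt c m` and `(x A)_j` is the parity of the column sum.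
[cite: BerlekampMcelieceVantilborg1978, §III.A (p. 385)] -/
theorem checks_iff {m n : ℕ} (A : Fin m → Fin n → ZMod 2) (yvec : Fin n → ZMod 2) (w : ℕ)
    (rows : ℕ → List Bool) (hrows : ∀ (i : Fin m) (j : Fin n), A i j = if (rows i).getD j false = true then 1 else 0)
    (yv : List Bool) (hyv : ∀ j : Fin n, yvec j = if yv.getD j false = true then 1 else 0) (c : List Bool) :
    (hammingNorm (fun i : Fin m => if c.getD i false = true then (1 : ZMod 2) else 0) ≤ w ∧
      Matrix.vecMul (fun i : Fin m => if c.getD i false = true then (1 : ZMod 2) else 0) (Matrix.of A) = yvec) ↔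
    (∑ i ∈ Finset.range m, (c.getD i false).toNat ≤ w ∧
      ∀ j < n, decide ((∑ i ∈ Finset.range m, (c.getD i false && (rows i).getD j false).toNat) % 2 = 1) = yv.getD j false) := by
  have hw : hammingNorm (fun i : Fin m => if c.getD i false = true then (1 : ZMod 2) else 0) =
      ∑ i ∈ Finset.range m, (c.getD i false).toNat := by
    rw [sum_range_toNat_eq_card]
    unfold hammingNorm
    exact congrArg Finset.card (Finset.filter_congr fun i _ => by
      dsimp only
      cases h : c.getD (i : ℕ) false <;> simp)
  have hcol : ∀ j : Fin n, Matrix.vecMul (fun i : Fin m => if c.getD i false = true then (1 : ZMod 2) else 0) (Matrix.of A) j =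
      ((∑ i ∈ Finset.range m, (c.getD i false && (rows i).getD j false).toNat : ℕ) : ZMod 2) := by
    intro j
    rw [sum_range_toNat_eq_card, Finset.natCast_card_filter, Matrix.vecMul, dotProduct]
    refine Finset.sum_congr rfl fun i _ => ?_
    dsimp only [Matrix.of_apply]
    rw [hrows i j]
    cases h1 : c.getD (i : ℕ) false <;> cases h2 : (rows (i : ℕ)).getD (j : ℕ) false <;> simp
  rw [hw]
  refine and_congr Iff.rfl ⟨fun h j hj => ?_, fun h => funext fun j => ?_⟩
  · have := congr_fun h ⟨j, hj⟩
    rw [hcol, hyv] at this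
    exact (natCast_eq_ite_iff _ _).1 this
  · rw [hcol, hyv]
    exact (natCast_eq_ite_iff _ _).2 (h j j.2)

/-- **Soundness**: an accepted pair codes a YES instance. [cite: BerlekampMcelieceVantilborg1978, §III (p. 385)] -/
theorem mem_of_accepts {x c : List Bool} (h : V (boolPair x c) = [true]) : x ∈ COSETWEIGHTS := by
  obtain ⟨hshape, hc, hwt, hpar⟩ := (V_eq_true_iff x c).1 h
  obtain ⟨hm, hn⟩ := clamps_of_goodShape hshape
  rw [hm] at hc hwt hpar
  rw [hn] at hpar
  rw [← encode_instOf hshape, COSETWEIGHTS, Computability.Encoding.mem_toLanguage_iff]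
  refine ⟨fun i => if c.getD i false = true then 1 else 0, ?_⟩
  exact (checks_iff (AOf x) (yvecOf x) (wOf x) (item x) (fun i j => rfl) (yvOf x) (fun j => rfl) c).2 ⟨hwt, hpar⟩

/-- Every element of `𝔽₂` is the indicator of being `1`. [folklore] -/
private theorem zmod2_eq_ite (a : ZMod 2) : a = if decide (a = 1) = true then 1 else 0 := by
  revert a; decide

/-- **Completeness**: a YES instance has a short accepted witness (the bits of `x`).
[cite: BerlekampMcelieceVantilborg1978, §III (p. 385)] -/
theorem accepts_of_mem (I : (Σ m : ℕ, Σ n : ℕ, (Fin m → Fin n → ZMod 2) × (Fin n → ZMod 2)) × ℕ)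
    (hI : I ∈ cosetWeightsSet) :
    ∃ c : List Bool, c.length ≤ ((encodingCosetInstance.pairBool encodingNatBool).encode I).length ∧
      V (boolPair ((encodingCosetInstance.pairBool encodingNatBool).encode I) c) = [true] := by
  obtain ⟨⟨m, n, A, yvec⟩, w⟩ := I
  obtain ⟨xv, hxw, hxA⟩ := hI
  obtain ⟨hm, hn⟩ := clamps_encode (⟨m, n, (A, yvec)⟩, w)
  obtain ⟨-, -, h3, h4, -⟩ := fields_encode (⟨m, n, (A, yvec)⟩, w)
  have hclen : (List.ofFn fun i : Fin m => decide (xv i = 1)).length = m := List.length_ofFn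
  have hcx : (fun i : Fin m => if (List.ofFn fun i : Fin m => decide (xv i = 1)).getD i false = true then (1 : ZMod 2) else 0) = xv := by
    funext i
    rw [List.getD_eq_getElem _ _ (by simp), List.getElem_ofFn]
    exact (zmod2_eq_ite (xv i)).symm
  refine ⟨List.ofFn fun i : Fin m => decide (xv i = 1), ?_, ?_⟩
  · rw [hclen]; exact m_le_length_encode (⟨m, n, (A, yvec)⟩, w)
  · rw [V_eq_true_iff, hm, hn, h3, h4]
    refine ⟨goodShape_encode _, hclen, ?_⟩
    refine (checks_iff A yvec w (item ((encodingCosetInstance.pairBool encodingNatBool).encode (⟨m, n, (A, yvec)⟩, w)))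
      (fun i j => ?_) ((encodingF2Vec n).encode yvec) (fun j => ?_) _).1 (by rw [hcx]; exact ⟨hxw, hxA⟩)
    · have hi : (List.ofFn fun i : Fin m => (encodingF2Vec n).encode (A i)).getD i [] = (encodingF2Vec n).encode (A i) := by
        rw [List.getD_eq_getElem _ _ (by simp), List.getElem_ofFn]
      rw [item_encode, hi]
      show A i j = if (List.ofFn fun j : Fin n => decide (A i j = 1)).getD j false = true then 1 else 0
      rw [List.getD_eq_getElem _ _ (by simp), List.getElem_ofFn]
      exact zmod2_eq_ite _
    · show yvec j = if (List.ofFn fun j : Fin n => decide (yvec j = 1)).getD j false = true then 1 else 0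
      rw [List.getD_eq_getElem _ _ (by simp), List.getElem_ofFn]
      exact zmod2_eq_ite _

/-- **COSET WEIGHTS is in `NP`** ("It is easy to see that both COSET WEIGHTS and SUBSPACE WEIGHTS
are in NP": guess the row selector `x`, check its weight and `xA = y`). The certificate is the bit
string of `x` (length `m ≤ |code|`); the verifier `V` checks that the input codes an instance, the
weight bound and the `n` column parities. [cite: BerlekampMcelieceVantilborg1978, §III (p. 385)] -/
theorem COSETWEIGHTS_mem_NP : COSETWEIGHTS ∈ Nondeterministic.NP := by
  refine ⟨Rlang, Rlang_mem_P, X, fun x => ⟨?_, ?_⟩⟩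
  · rintro ⟨I, hI, rfl⟩
    obtain ⟨c, hc, hV⟩ := accepts_of_mem I hI
    exact ⟨c, by rw [eval_X]; exact hc, hV⟩
  · rintro ⟨c, -, hc⟩
    exact mem_of_accepts hc

end CosetWeightsNP

/-- **Berlekamp–McEliece–van Tilborg 1978: COSET WEIGHTS is NP-complete** ("This proves that COSET
WEIGHTS is NP-complete", §III p. 385): in `NP` by the row-selector certificate
(`CosetWeightsNP.COSETWEIGHTS_mem_NP`) and NP-hard by `THREEDM ≤ₚ COSETWEIGHTS`
(`BerlekampMcElieceVanTilborg1978_cosetWeights_isNPHard`, `DecodingHardness.lean`). The general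
decoding problem for binary linear codes (find a coset member of weight `≤ w`) is therefore
NP-complete. [cite: BerlekampMcelieceVantilborg1978, §III (p. 385)] -/
theorem BerlekampMcElieceVanTilborg1978_cosetWeights_isNPComplete : IsNPComplete COSETWEIGHTS :=
  ⟨CosetWeightsNP.COSETWEIGHTS_mem_NP, BerlekampMcElieceVanTilborg1978_cosetWeights_isNPHard⟩

end Literature.InformationTheory.Coding

end
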